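import Mathlib
import Summits.NavierStokesRegularity.NavierStokesRegularity.Theorems.DssFarFieldSlavingBlowupTypeIDssProfileSimilarityEnstrophyMixedCore
import Literature.Analysis.Calculus.CoulombUncertainty
import Literature.Analysis.FluidPDE.TypeIAncientMildDecay
import HarnessLib

/-!
# E3′ / T47 (Tier 2) and portrait Row 6: the MIXED-CONSTANT / ENVELOPE threshold with the Coulomb
  uncertainty constant — classical (unconditional), at CLASS level, and the HYPERBOLA portrait
  floor (pub-ns-dss theory ENVELOPE-FLOOR.md v1.1 7d4ff1ae9522137b, Tier 2; lead A422 (b)/(4),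
  A425 (b); route `DssFarFieldSlaving`, crux `BlowupTypeIDssProfile`,
  stmt-NavierStokesRegularity-0155 — SUPPORT; typer seat g9, 2026-08-24)

HONEST FRAMING. Exclusion statements about a HYPOTHETICAL object (a Type-I ancient mild solution in
the KNSS gauge / a member of the rotated-DSS Type-I class), in the currency of the scale-invariant
MIXED constant `P`: `‖x‖·√(−t)·‖V(t,x)‖² ≤ P` (`P ≤ M_t·A_sp` for the time-only / space-only
constants; `P ≤ C₀²/4` under the envelope `HasTypeIDecay C₀ V`). This file replaces the Hardy-based
intermediate-weight bound of the Tier-1 file (`…SimilarityEnstrophyMixedThreshold.lean`, factor `2`)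
by the COULOMB UNCERTAINTY PRINCIPLE `κ∫f²/‖y‖ ≤ ∫‖∇f‖² + (κ²/4)∫f²` (Lieb–Seiringer 2010,
(2.2.17)–(2.2.18); tree: `Literature.Analysis.Calculus.coulomb_sq_integral_le_three`, applied
componentwise to the similarity vorticity): `Str ≤ D + (27P²/256)Z`, so the unweighted
similarity-enstrophy budget `½Z′ = −D − ¼Z + Str` closes at rate `½ − 27P²/128`
(`typeI_ancient_eq_zero_of_stretching_le`). CLASSICAL: `P² < 64/27` (`P < 8/(3√3) ≈ 1.5396`) ⇒
`V ≡ 0` at ANY Type-I level — GIVEN (D) and UNCONDITIONALLY ((D) = the tree's Literature theorem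
`IsTypeIAncientMild.gaugeBounds_of_hasTypeIDecay`); ENVELOPE: `C₀⁴ < 1024/27` ⇒ `V ≡ 0`; CLASS: the
hypothesis class of `RdssProfileTruncation` (any `c > 1`, ANY twist `R ∈ O(3)`) at space–time Type-I
level `M` is EMPTY for every `M⁴ < 1024/27` (`M < (1024/27)^{1/4} ≈ 2.4816`; decimal surrogate
`M ≤ 62/25`) — the VERBATIM class shape of `rdssClass_empty_of_typeI_lt_one` (every `M < 1`,
p366221, which stays the discharge's) and of the Tier-1 `rdssClass_empty_of_typeI_pow_four_lt`
(`M⁴ < 256/27`), containing both; PORTRAITS (∀-representative shapes of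
`rdssClass_empty_of_spaceConstant` / `GaussianGap.rdssClass_empty_of_twoConstant`): at every level
`M`, no non-trivial member has all its smooth KNSS representatives with `P² < 64/27`, resp. with
time-only and space-only constants `θ`, `A`, `(θA)² < 64/27` — every survivor with finite
`(M_t, A_sp)` lies on or above the HYPERBOLA `M_t·A_sp ≥ 8/(3√3)` («Row 6»; NOT implied by Rows
2′/4/5, which allow `(M_t, A_sp) = (1.3, 1.1)`). METHOD constants (Coulomb ground state, Young
`2/3`); no sharpness claimed; nothing for larger `M`. DSS-BLIND: the class proofs discard `c`, `R`,
`IsRotatedDSS`. Derivation: theory seat (ENVELOPE-FLOOR.md §3 Tier 2, DERIVED — combination of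
printed steps; red ×2 requested 2026-08-24); typed on the T47 core. PRINTED CONTEXT: the Coulomb
uncertainty principle is Lieb–Seiringer (2.2.17)–(2.2.18) (typed in the tree, cited there); KNSS
2009 / Seregin 2014 comparators only. Census words on ACCEPT, if any, are the lead's. Nothing numeric
about any candidate; nothing here bears on Navier–Stokes regularity or blow-up.
-/

noncomputable section

set_option linter.dupNamespace false

namespace Summit.NavierStokesRegularity.NavierStokesRegularity.Theorems.SimilarityEnstrophy

open MeasureTheory Set Filter Topology Module Metric InnerProductSpace Function
open scoped RealInnerProductSpace Laplacian ContDiff ENNReal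
open Literature.Analysis Literature.Analysis.FluidPDE Literature.Analysis.Calculus
open Summit.NavierStokesRegularity.NavierStokesRegularity.Theorems.GaussianGap
open Summit.NavierStokesRegularity.NavierStokesRegularity.Theorems.PlanarEnergyAPriori

variable {M : ℝ} {V : ℝ → EuclideanSpace ℝ (Fin 3) → EuclideanSpace ℝ (Fin 3)}

/-- **The intermediate weight from the Coulomb uncertainty principle (Tier 2).** Under (D) at
orders `1, 2` the function `‖Ω(s,y)‖²/‖y‖` is integrable and, for every `κ ≥ 0`,
`κ ∫ ‖Ω‖²/‖y‖ ≤ ∫|∇Ω|²_F + (κ²/4) ∫‖Ω‖²`: the scalar inequality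
`Literature.Analysis.Calculus.coulomb_sq_integral_le_three` component by component
(`‖Ω‖² = Σᵢ Ωᵢ²`, `|∇Ω|²_F = Σᵢ ‖DΩᵢ‖²`). [cite: LiebSeiringer2009, §2.2.2 (2.2.17)–(2.2.18)] -/
theorem integral_norm_sq_div_norm_le_coulomb (hV : IsTypeIAncientMild M V) {C₁ C₂ : ℝ}
    (hD1 : ∀ t < 0, ∀ x, (‖x‖ + Real.sqrt (-t)) ^ (1 + 1) * ‖iteratedFDeriv ℝ 1 (V t) x‖ ≤ C₁)
    (hD2 : ∀ t < 0, ∀ x, (‖x‖ + Real.sqrt (-t)) ^ (2 + 1) * ‖iteratedFDeriv ℝ 2 (V t) x‖ ≤ C₂)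
    (s : ℝ) {κ : ℝ} (hκ : 0 ≤ κ) :
    Integrable (fun y => ‖lerayVorticity V s y‖ ^ 2 / ‖y‖) ∧
      κ * ∫ y, ‖lerayVorticity V s y‖ ^ 2 / ‖y‖ ≤
        (∫ y, frobeniusNormSq (fderiv ℝ (lerayVorticity V s) y)) +
          κ ^ 2 / 4 * ∫ y, ‖lerayVorticity V s y‖ ^ 2 := by
  have hE : finrank ℝ (EuclideanSpace ℝ (Fin 3)) = 3 := finrank_euclideanSpace_fin
  set Ω := lerayVorticity V s with hΩdef
  have hΩ : ContDiff ℝ ∞ Ω := contDiff_lerayVorticity_slice hV s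
  have hΩ1 : ContDiff ℝ 1 Ω := hΩ.of_le (by norm_cast)
  have iZ : Integrable fun y => ‖Ω y‖ ^ 2 := integrable_norm_lerayVorticity_sq hV hD1 s
  have iF : Integrable fun y => frobeniusNormSq (fderiv ℝ Ω y) :=
    integrable_frobeniusNormSq_fderiv_lerayVorticity hV hD2 s
  -- components
  have hci : ∀ i : Fin 3, ContDiff ℝ 1 (fun z => Ω z i) := fun i => contDiff_euclidean.1 hΩ1 i
  have hfrob : ∀ y, frobeniusNormSq (fderiv ℝ Ω y) = ∑ i, ‖fderiv ℝ (fun z => Ω z i) y‖ ^ 2 :=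
    fun y => frobeniusNormSq_fderiv_eq_sum_norm_fderiv_coord_sq ((hΩ1.differentiable one_ne_zero) y)
  have hnsq : ∀ y, ‖Ω y‖ ^ 2 = ∑ i, (Ω y i) ^ 2 := fun y => by
    rw [EuclideanSpace.norm_sq_eq]
    simp only [Real.norm_eq_abs, sq_abs]
  have hu2 : ∀ i : Fin 3, Integrable fun y => (Ω y i) ^ 2 := by
    intro i
    refine iZ.mono' (((hci i).continuous.pow 2).aestronglyMeasurable) (ae_of_all _ fun y => ?_)
    rw [Real.norm_of_nonneg (sq_nonneg _), hnsq y]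
    exact Finset.single_le_sum (f := fun j => (Ω y j) ^ 2) (fun j _ => sq_nonneg _)
      (Finset.mem_univ i)
  have hDu2 : ∀ i : Fin 3, Integrable fun y => ‖fderiv ℝ (fun z => Ω z i) y‖ ^ 2 := by
    intro i
    refine iF.mono' ((((hci i).continuous_fderiv one_ne_zero).norm.pow 2).aestronglyMeasurable)
      (ae_of_all _ fun y => ?_)
    rw [Real.norm_of_nonneg (sq_nonneg _), hfrob y]
    exact Finset.single_le_sum (f := fun j => ‖fderiv ℝ (fun z => Ω z j) y‖ ^ 2)
      (fun j _ => sq_nonneg _) (Finset.mem_univ i)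
  have hcomp := fun i : Fin 3 => coulomb_sq_integral_le_three (hci i) (hu2 i) (hDu2 i) hE hκ
  -- sum over the components
  have hint : Integrable fun y => ‖Ω y‖ ^ 2 / ‖y‖ := by
    have : (fun y => ‖Ω y‖ ^ 2 / ‖y‖) = fun y => ∑ i, (Ω y i) ^ 2 / ‖y‖ := by
      funext y
      rw [hnsq y, Finset.sum_div]
    rw [this]
    exact integrable_finsetSum _ fun i _ => (hcomp i).1
  refine ⟨hint, ?_⟩
  have e1 : ∫ y, ‖Ω y‖ ^ 2 / ‖y‖ = ∑ i, ∫ y, (Ω y i) ^ 2 / ‖y‖ := by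
    rw [← integral_finsetSum _ fun i _ => (hcomp i).1]
    refine integral_congr_ae (ae_of_all _ fun y => ?_)
    show ‖Ω y‖ ^ 2 / ‖y‖ = ∑ i, (Ω y i) ^ 2 / ‖y‖
    rw [hnsq y, Finset.sum_div]
  have e2 : ∫ y, frobeniusNormSq (fderiv ℝ Ω y) = ∑ i, ∫ y, ‖fderiv ℝ (fun z => Ω z i) y‖ ^ 2 := by
    rw [← integral_finsetSum _ fun i _ => hDu2 i]
    exact integral_congr_ae (ae_of_all _ fun y => hfrob y)
  have e3 : ∫ y, ‖Ω y‖ ^ 2 = ∑ i, ∫ y, (Ω y i) ^ 2 := by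
    rw [← integral_finsetSum _ fun i _ => hu2 i]
    exact integral_congr_ae (ae_of_all _ fun y => hnsq y)
  rw [e1, e2, e3, Finset.mul_sum, Finset.mul_sum, ← Finset.sum_add_distrib]
  exact Finset.sum_le_sum fun i _ => (hcomp i).2

/-- **The stretching bound from the MIXED constant, Tier 2** (theory ENVELOPE-FLOOR §3 (3.3)):
`Str(s) ≤ ∫|∇Ω(s)|²_F + (27P²/256) Z(s)` — the core's
`integral_stretching_le_dissipation_add_mixedWeight` (`Str ≤ (2/3)D + (3P/8)∫‖Ω‖²/‖y‖`) plus the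
Coulomb weight bound with `κ = 9P/8`. [this file; theory T47 Tier 2] -/
theorem integral_stretching_le_of_mixedConstant_coulomb (hV : IsTypeIAncientMild M V) {C₁ C₂ : ℝ}
    (hD1 : ∀ t < 0, ∀ x, (‖x‖ + Real.sqrt (-t)) ^ (1 + 1) * ‖iteratedFDeriv ℝ 1 (V t) x‖ ≤ C₁)
    (hD2 : ∀ t < 0, ∀ x, (‖x‖ + Real.sqrt (-t)) ^ (2 + 1) * ‖iteratedFDeriv ℝ 2 (V t) x‖ ≤ C₂)
    {P : ℝ} (hP : ∀ t < 0, ∀ x, ‖x‖ * Real.sqrt (-t) * ‖V t x‖ ^ 2 ≤ P) (s : ℝ) :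
    ∫ y, ⟪lerayVorticity V s y, fderiv ℝ (lerayOrbit V s) y (lerayVorticity V s y)⟫ ≤
      (∫ y, frobeniusNormSq (fderiv ℝ (lerayVorticity V s) y)) +
        (27 * P ^ 2 / 256) * ∫ y, ‖lerayVorticity V s y‖ ^ 2 := by
  have h1 := integral_stretching_le_dissipation_add_mixedWeight hV hD1 hD2 hP s
  have hP0 : 0 ≤ P := mixedConstant_nonneg hP
  have h2 := (integral_norm_sq_div_norm_le_coulomb hV hD1 hD2 s
    (by positivity : (0 : ℝ) ≤ 9 * P / 8)).2
  set D : ℝ := ∫ y, frobeniusNormSq (fderiv ℝ (lerayVorticity V s) y) with hD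
  set Z : ℝ := ∫ y, ‖lerayVorticity V s y‖ ^ 2 with hZ
  set X : ℝ := ∫ y, ‖lerayVorticity V s y‖ ^ 2 / ‖y‖ with hX
  -- `(3P/8) X = (1/3)(9P/8) X ≤ (1/3)(D + (81P²/256) Z)`
  have hmid : 3 * P / 8 * X ≤ 1 / 3 * D + 27 * P ^ 2 / 256 * Z := by
    have e : (9 * P / 8) ^ 2 / 4 = 81 * P ^ 2 / 256 := by ring
    rw [e] at h2
    linarith
  linarith

/-- **T47 under (D), CLASSICAL level, Tier 2** (theory ENVELOPE-FLOOR): a KNSS-gauge Type-I field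
(`IsTypeIAncientMild M V`, ANY `M`) with mixed constant `P² < 64/27` (`P < 8/(3√3)`) and the gauge
bounds (D) of orders `1, 2, 3` vanishes on `t < 0` (`Str ≤ D + (27P²/256)Z`, `27P²/256 < ¼`,
`typeI_ancient_eq_zero_of_stretching_le`; rate `½ − 27P²/128`). [this file; theory T47 Tier 2] -/
theorem typeI_ancient_eq_zero_of_mixedConstant_coulomb_of_decay (hV : IsTypeIAncientMild M V)
    {P : ℝ} (hP : ∀ t < 0, ∀ x, ‖x‖ * Real.sqrt (-t) * ‖V t x‖ ^ 2 ≤ P) (hPlt : P ^ 2 < 64 / 27)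
    {C₁ C₂ C₃ : ℝ}
    (hD1 : ∀ t < 0, ∀ x, (‖x‖ + Real.sqrt (-t)) ^ (1 + 1) * ‖iteratedFDeriv ℝ 1 (V t) x‖ ≤ C₁)
    (hD2 : ∀ t < 0, ∀ x, (‖x‖ + Real.sqrt (-t)) ^ (2 + 1) * ‖iteratedFDeriv ℝ 2 (V t) x‖ ≤ C₂)
    (hD3 : ∀ t < 0, ∀ x, (‖x‖ + Real.sqrt (-t)) ^ (3 + 1) * ‖iteratedFDeriv ℝ 3 (V t) x‖ ≤ C₃) :
    ∀ t < 0, ∀ x, V t x = 0 :=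
  typeI_ancient_eq_zero_of_stretching_le hV hD1 hD2 hD3 (β := 27 * P ^ 2 / 256) (by nlinarith)
    fun s => integral_stretching_le_of_mixedConstant_coulomb hV hD1 hD2 hP s

/-- **T47, CLASSICAL level, UNCONDITIONAL, Tier 2** («P < 8/(3√3) ⇒ V ≡ 0»): a KNSS-gauge Type-I
field `V` (`IsTypeIAncientMild M V`, any `M`) with the envelope `HasTypeIDecay C₀ V` (any `C₀`) and
mixed constant `P² < 64/27` vanishes on `t < 0`; (D) from
`IsTypeIAncientMild.gaugeBounds_of_hasTypeIDecay` at level `max M C₀`. NO named input.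
[this file; theory T47 Tier 2; nothing here bears on NS regularity] -/
theorem typeI_ancient_eq_zero_of_mixedConstant_coulomb (hV : IsTypeIAncientMild M V) {C₀ : ℝ}
    (hdec : HasTypeIDecay C₀ V) {P : ℝ}
    (hP : ∀ t < 0, ∀ x, ‖x‖ * Real.sqrt (-t) * ‖V t x‖ ^ 2 ≤ P) (hPlt : P ^ 2 < 64 / 27) :
    ∀ t < 0, ∀ x, V t x = 0 := by
  have hV' : IsTypeIAncientMild (max M C₀) V := isTypeIAncientMild_mono hV (le_max_left _ _)
  have hdec' : HasTypeIDecay (max M C₀) V := fun t ht x =>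
    (hdec t ht x).trans (div_le_div_of_nonneg_right (le_max_right _ _) (by positivity))
  obtain ⟨C₁, C₂, C₃, hD1, hD2, hD3⟩ := IsTypeIAncientMild.gaugeBounds_of_hasTypeIDecay hV' hdec'
  exact typeI_ancient_eq_zero_of_mixedConstant_coulomb_of_decay hV' hP hPlt hD1 hD2 hD3

/-- **T47-E (envelope currency), CLASSICAL, UNCONDITIONAL, Tier 2**: `HasTypeIDecay C₀ V` with
`C₀⁴ < 1024/27` (`C₀ < (1024/27)^{1/4} = 2(4/3)^{3/4} ≈ 2.4816`) ⇒ `V ≡ 0` on `t < 0`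
(`P ≤ C₀²/4`, `(C₀²/4)² < 64/27`). [this file; theory T47-E Tier 2] -/
theorem typeI_ancient_eq_zero_of_hasTypeIDecay_pow_four_lt_coulomb (hV : IsTypeIAncientMild M V)
    {C₀ : ℝ} (hdec : HasTypeIDecay C₀ V) (hC : C₀ ^ 4 < 1024 / 27) : ∀ t < 0, ∀ x, V t x = 0 :=
  typeI_ancient_eq_zero_of_mixedConstant_coulomb hV hdec (mixedConstant_le_of_hasTypeIDecay hdec)
    (by nlinarith)

/-- **E3′-ENV at CLASS level, UNCONDITIONAL, Tier 2**: the hypothesis class of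
`RdssProfileTruncation` (any `c > 1`, ANY twist `R ∈ O(3)`) at space–time Type-I level `M` is EMPTY
for every `M⁴ < 1024/27` (`M < (1024/27)^{1/4} ≈ 2.4816`) — the VERBATIM class shape of
`rdssClass_empty_of_typeI_lt_one` (every `M < 1`) and of the Tier-1
`rdssClass_empty_of_typeI_pow_four_lt` (`M⁴ < 256/27`), containing both. Proof: the smooth KNSS
representative (`typeI_ancient_smoothRepresentative_ae`) carries `HasTypeIDecay M V` and vanishes by
`typeI_ancient_eq_zero_of_hasTypeIDecay_pow_four_lt_coulomb`. DSS-blind; a METHOD threshold, no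
sharpness claimed. [this file; theory E3′-ENV Tier 2; census words on ACCEPT, if any, are the
lead's; nothing here bears on NS regularity] -/
theorem rdssClass_empty_of_typeI_pow_four_lt_coulomb {M : ℝ} (hM : M ^ 4 < 1024 / 27) :
    ¬ ∃ (c : ℝ) (R : (EuclideanSpace ℝ (Fin 3)) ≃ₗᵢ[ℝ] (EuclideanSpace ℝ (Fin 3)))
        (u : ℝ → (EuclideanSpace ℝ (Fin 3)) → (EuclideanSpace ℝ (Fin 3))),
      1 < c ∧ IsAncientMildSolution 1 u ∧ (∀ t < 0, AEStronglyMeasurable (u t) volume) ∧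
      IsRotatedDSS c R u ∧ HasTypeIDecay M u ∧ ¬ (∀ t < 0, u t =ᵐ[volume] 0) := by
  rintro ⟨c, R, u, -, hmild, hmeas, -, hdec, hne⟩
  obtain ⟨V, hT, hdecV, hVu, -⟩ := typeI_ancient_smoothRepresentative_ae hmild hmeas hdec
  have hz : ∀ t < 0, ∀ x, V t x = 0 :=
    typeI_ancient_eq_zero_of_hasTypeIDecay_pow_four_lt_coulomb hT hdecV hM
  refine hne fun t ht => ?_
  have hVz : V t = 0 := funext fun x => by simpa using hz t ht x
  exact (hVu t ht).symm.trans (Filter.EventuallyEq.of_eq hVz)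

/-- **E3′-ENV, Tier 2, decimal surrogate**: the class at level `M` is empty for every `M ≤ 62/25`
(`= 2.48`; `(62/25)⁴ < 1024/27`; for `M < 0` the hypothesis `HasTypeIDecay M u` is already
contradictory at `(t,x) = (−1,0)`). [this file] -/
theorem rdssClass_empty_of_typeI_le_coulomb {M : ℝ} (hM : M ≤ 62 / 25) :
    ¬ ∃ (c : ℝ) (R : (EuclideanSpace ℝ (Fin 3)) ≃ₗᵢ[ℝ] (EuclideanSpace ℝ (Fin 3)))
        (u : ℝ → (EuclideanSpace ℝ (Fin 3)) → (EuclideanSpace ℝ (Fin 3))),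
      1 < c ∧ IsAncientMildSolution 1 u ∧ (∀ t < 0, AEStronglyMeasurable (u t) volume) ∧
      IsRotatedDSS c R u ∧ HasTypeIDecay M u ∧ ¬ (∀ t < 0, u t =ᵐ[volume] 0) := by
  rcases lt_or_ge M 0 with hneg | hnn
  · rintro ⟨c, R, u, -, -, -, -, hdec, -⟩
    have h0 : 0 ≤ M := by simpa using (norm_nonneg _).trans (hdec (-1) (by norm_num) 0)
    exact absurd h0 (not_le.2 hneg)
  · refine rdssClass_empty_of_typeI_pow_four_lt_coulomb ?_
    have h2 : M ^ 2 ≤ (62 / 25) ^ 2 := pow_le_pow_left₀ hnn hM 2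
    nlinarith

/-- **The mixed-constant PORTRAIT FLOOR at CLASS level, UNCONDITIONAL, Tier 2** (∀-representative
shape of `rdssClass_empty_of_spaceConstant`): at EVERY space–time Type-I level `M`, no non-trivial
member of the class has all its smooth KNSS representatives (`IsTypeIAncientMild M V`, `V(t) = u(t)`
a.e.) obeying `‖x‖·√(−t)·‖V(t,x)‖² ≤ P` with `P² < 64/27` — every survivor has `P ≥ 8/(3√3)`.
DSS-blind. [this file; theory T47-P Tier 2; census words on ACCEPT, if any, are the lead's; nothing
numerical is asserted and nothing here bears on NS regularity] -/
theorem rdssClass_empty_of_mixedConstant_coulomb (M : ℝ) {P : ℝ} (hPlt : P ^ 2 < 64 / 27) :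
    ¬ ∃ (c : ℝ) (R : (EuclideanSpace ℝ (Fin 3)) ≃ₗᵢ[ℝ] (EuclideanSpace ℝ (Fin 3)))
        (u : ℝ → (EuclideanSpace ℝ (Fin 3)) → (EuclideanSpace ℝ (Fin 3))),
      1 < c ∧ IsAncientMildSolution 1 u ∧ (∀ t < 0, AEStronglyMeasurable (u t) volume) ∧
      IsRotatedDSS c R u ∧ HasTypeIDecay M u ∧
      (∀ V : ℝ → EuclideanSpace ℝ (Fin 3) → EuclideanSpace ℝ (Fin 3), IsTypeIAncientMild M V →
        (∀ t < 0, V t =ᵐ[volume] u t) →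
        ∀ t < 0, ∀ x, ‖x‖ * Real.sqrt (-t) * ‖V t x‖ ^ 2 ≤ P) ∧
      ¬ (∀ t < 0, u t =ᵐ[volume] 0) := by
  rintro ⟨c, R, u, -, hmild, hmeas, -, hdec, hrep, hne⟩
  obtain ⟨V, hT, hdecV, hVu, -⟩ := typeI_ancient_smoothRepresentative_ae hmild hmeas hdec
  have hz : ∀ t < 0, ∀ x, V t x = 0 :=
    typeI_ancient_eq_zero_of_mixedConstant_coulomb hT hdecV (hrep V hT hVu) hPlt
  refine hne fun t ht => ?_
  have hVz : V t = 0 := funext fun x => by simpa using hz t ht x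
  exact (hVu t ht).symm.trans (Filter.EventuallyEq.of_eq hVz)

/-- **The HYPERBOLA in the two-constant portrait, CLASSICAL, UNCONDITIONAL** (theory ENVELOPE-FLOOR
«PORTRAIT-2C», Tier 2): a KNSS-gauge Type-I field (`IsTypeIAncientMild M V`, any `M`) with time-only
constant `θ` (`√(−t)‖V(t,x)‖ ≤ θ`) and space-only constant `A` (`‖x‖‖V(t,x)‖ ≤ A`) satisfying
`(θA)² < 64/27` (`θA < 8/(3√3) ≈ 1.5396`) vanishes on `t < 0` (`P ≤ θA`; the envelope
`HasTypeIDecay (M + A) V` of `hasTypeIDecay_of_typeI_of_spaceConstant` discharges (D)). Incomparable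
with Row 2′ (`θ < 1`), Row 4 (`θ² + 3A < 4`) and Row 5 (`A ≤ ½`); not implied by them jointly (they
allow `(θ, A) = (1.3, 1.1)`). [this file; theory PORTRAIT-2C Tier 2] -/
theorem typeI_ancient_eq_zero_of_timeConstant_mul_spaceConstant (hV : IsTypeIAncientMild M V)
    {θ A : ℝ} (hθ : ∀ t < 0, ∀ x, Real.sqrt (-t) * ‖V t x‖ ≤ θ)
    (hA : ∀ t < 0, ∀ x, ‖x‖ * ‖V t x‖ ≤ A) (hθA : (θ * A) ^ 2 < 64 / 27) :
    ∀ t < 0, ∀ x, V t x = 0 :=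
  typeI_ancient_eq_zero_of_mixedConstant_coulomb hV (hasTypeIDecay_of_typeI_of_spaceConstant hV hA)
    (mixedConstant_le_of_timeConstant_of_spaceConstant hθ hA) hθA

/-- **Row 6 — the hyperbola PORTRAIT FLOOR at CLASS level, UNCONDITIONAL** (∀-representative shape of
`GaussianGap.rdssClass_empty_of_twoConstant`): at EVERY space–time Type-I level `M`, no non-trivial
member of the class has all its smooth KNSS representatives with time-only constant `θ` and
space-only constant `A` satisfying `(θA)² < 64/27` — every survivor with finite `(M_t, A_sp)` lies on
or above the hyperbola `M_t·A_sp ≥ 8/(3√3)`. DSS-blind. [this file; theory Row 6; census words on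
ACCEPT, if any, are the lead's; nothing here bears on NS regularity] -/
theorem rdssClass_empty_of_timeConstant_mul_spaceConstant (M : ℝ) {θ A : ℝ}
    (hθA : (θ * A) ^ 2 < 64 / 27) :
    ¬ ∃ (c : ℝ) (R : (EuclideanSpace ℝ (Fin 3)) ≃ₗᵢ[ℝ] (EuclideanSpace ℝ (Fin 3)))
        (u : ℝ → (EuclideanSpace ℝ (Fin 3)) → (EuclideanSpace ℝ (Fin 3))),
      1 < c ∧ IsAncientMildSolution 1 u ∧ (∀ t < 0, AEStronglyMeasurable (u t) volume) ∧
      IsRotatedDSS c R u ∧ HasTypeIDecay M u ∧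
      (∀ V : ℝ → EuclideanSpace ℝ (Fin 3) → EuclideanSpace ℝ (Fin 3), IsTypeIAncientMild M V →
        (∀ t < 0, V t =ᵐ[volume] u t) →
        (∀ t < 0, ∀ x, Real.sqrt (-t) * ‖V t x‖ ≤ θ) ∧ ∀ t < 0, ∀ x, ‖x‖ * ‖V t x‖ ≤ A) ∧
      ¬ (∀ t < 0, u t =ᵐ[volume] 0) := by
  rintro ⟨c, R, u, -, hmild, hmeas, -, hdec, hrep, hne⟩
  obtain ⟨V, hT, -, hVu, -⟩ := typeI_ancient_smoothRepresentative_ae hmild hmeas hdec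
  obtain ⟨hθ, hA⟩ := hrep V hT hVu
  have hz : ∀ t < 0, ∀ x, V t x = 0 :=
    typeI_ancient_eq_zero_of_timeConstant_mul_spaceConstant hT hθ hA hθA
  refine hne fun t ht => ?_
  have hVz : V t = 0 := funext fun x => by simpa using hz t ht x
  exact (hVu t ht).symm.trans (Filter.EventuallyEq.of_eq hVz)

end Summit.NavierStokesRegularity.NavierStokesRegularity.Theorems.SimilarityEnstrophy
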